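import Summits.AtomisticToContinuum.FouriersLaw.Theorems.EmbeddedDrudeMourreFGRGapBranchA
import Summits.AtomisticToContinuum.FouriersLaw.Theorems.EmbeddedDrudeMourreFGRGapGenericA

/-!
# FGRGap, line `fold-jet-rigidity`, stub `stub_branchStructure` — part B: the partner map

Support for the registered stub `stub_branchStructure` (GA) of crux `EmbeddedDrudeMourre.FGRGap`
(item stmt-AtomisticToContinuum-12595), continuing part A (`…FGRGapBranchA`); cell and periodicity
lemmas are reused from `…FGRGapGenericA` (namespace `…FoldJetRigidity.Generic`).

A PARTNER SELECTOR is any `h : ℝ → ℝ → ℝ` with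
* (H1) `h k₁ k₃ ∈ resonantSet ω₂ k₁ k₃`;
* (H2) on the diagonal `k₃ - k₁ ∈ 2πℤ`, `h k₁ k₃ = k₃ mod 2π` (the representative in `(-π, π]`);
* (H3) off the diagonal, `h k₁ k₃ = k₃ mod 2π` only if the resonant set is `{k₃ mod 2π}`.
Selectors exist (`exists_selector`, by choice), and by the two-root algebra of part A any selector
has the elementary GA properties: off the diagonal `resonantSet ω₂ k₁ k₃ = {k₃ mod 2π, h k₁ k₃}`
(`resonantSet_eq_pair`), hence `h` is doubly `2π`-periodic (`selector_periodic`), `h k k = k` on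
the cell, the branch is trivial iff `v(k₃) = v(k₁)` (`selector_trivial_iff`), and off that curve
`v(h) ≠ v(k₁ + h - k₃)` (`selector_velocity_ne`).
-/

noncomputable section

open MeasureTheory Set Real Filter Topology
open scoped ENNReal
open Literature.MathematicalPhysics.KineticTheory.PhononBoltzmann

namespace Summit.AtomisticToContinuum.FouriersLaw.Theorems.FGRGap.FoldJetRigidity.Branch

variable {ω₂ : ℝ}

/-! ## The cell `(-π, π]` and `k mod 2π` -/

/-- `k mod 2π ≡ k`, difference form. [folklore] -/
theorem toIocMod_sub_eq_int (x : ℝ) :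
    ∃ n : ℤ, toIocMod Real.two_pi_pos (-π) x - x = n * (2 * π) := by
  obtain ⟨n, hn⟩ := Generic.exists_toIocMod_eq_add (-π) x
  exact ⟨n, by rw [hn]; ring⟩

/-- Two congruent points of the cell are equal. [folklore] -/
theorem eq_of_mem_cell {a b : ℝ} (ha : a ∈ Ioc (-π) π) (hb : b ∈ Ioc (-π) π)
    (h : ∃ n : ℤ, b - a = n * (2 * π)) : b = a := by
  obtain ⟨n, hn⟩ := h
  have h1 : (-1 : ℝ) * (2 * π) < n * (2 * π) := by rw [← hn]; linarith [ha.2, hb.1]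
  have h2 : (n : ℝ) * (2 * π) < 1 * (2 * π) := by rw [← hn]; linarith [ha.1, hb.2]
  have hn1 : (-1 : ℝ) < n := lt_of_mul_lt_mul_right h1 two_pi_pos.le
  have hn2 : (n : ℝ) < 1 := lt_of_mul_lt_mul_right h2 two_pi_pos.le
  have i1 : (-1 : ℤ) < n := by exact_mod_cast hn1
  have i2 : n < 1 := by exact_mod_cast hn2
  have hn0 : n = 0 := by omega
  rw [hn0] at hn
  simp only [Int.cast_zero, zero_mul, sub_eq_zero] at hn
  exact hn

/-- On the cell `k mod 2π = k`. [folklore] -/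
theorem toIocMod_eq_self_of_mem {x : ℝ} (hx : x ∈ Ioc (-π) π) :
    toIocMod Real.two_pi_pos (-π) x = x := by
  rw [toIocMod_eq_self, show -π + 2 * π = π by ring]
  exact hx

/-- Congruent points have the same representative. [folklore] -/
theorem toIocMod_eq_of_modEq {x y : ℝ} (h : ∃ n : ℤ, y - x = n * (2 * π)) :
    toIocMod Real.two_pi_pos (-π) y = toIocMod Real.two_pi_pos (-π) x := by
  obtain ⟨n, hn⟩ := h
  rw [show y = x + n • (2 * π) by rw [zsmul_eq_mul]; linarith, toIocMod_add_zsmul]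

/-- Points with the same representative are congruent. [folklore] -/
theorem modEq_of_toIocMod_eq {x y : ℝ}
    (h : toIocMod Real.two_pi_pos (-π) y = toIocMod Real.two_pi_pos (-π) x) :
    ∃ n : ℤ, y - x = n * (2 * π) := by
  obtain ⟨a, ha⟩ := toIocMod_sub_eq_int x
  obtain ⟨b, hb⟩ := toIocMod_sub_eq_int y
  exact ⟨a - b, by push_cast; linarith⟩

/-- `(k + 2π) mod 2π = k mod 2π`. [folklore] -/
theorem toIocMod_add_two_pi_eq (x : ℝ) :
    toIocMod Real.two_pi_pos (-π) (x + 2 * π) = toIocMod Real.two_pi_pos (-π) x :=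
  toIocMod_eq_of_modEq ⟨1, by push_cast; ring⟩

/-! ## Periodicity of the resonance data -/

/-- `Ω` is `2π`-periodic in `k₃`. [folklore] -/
theorem resonanceFn_add_two_pi₃ (ω₂ k₁ k₂ k₃ : ℝ) :
    resonanceFn ω₂ k₁ k₂ (k₃ + 2 * π) = resonanceFn ω₂ k₁ k₂ k₃ := by
  unfold resonanceFn
  rw [dispersion_periodic ω₂ k₃, show k₁ + k₂ - (k₃ + 2 * π) = k₁ + k₂ - k₃ - 2 * π by ring,
    (dispersion_periodic ω₂).sub_eq]

/-- The resonant set is `2π`-periodic in `k₃`. [folklore] -/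
theorem resonantSet_add_two_pi₃ (ω₂ k₁ k₃ : ℝ) :
    resonantSet ω₂ k₁ (k₃ + 2 * π) = resonantSet ω₂ k₁ k₃ := by
  ext k₂
  simp [resonantSet, resonanceFn_add_two_pi₃]

/-- The representative of a zero of `Ω(k₁, ·, k₃)` is resonant. [folklore] -/
theorem toIocMod_mem_resonantSet_of_zero {k₁ k₂ k₃ : ℝ} (h : resonanceFn ω₂ k₁ k₂ k₃ = 0) :
    toIocMod Real.two_pi_pos (-π) k₂ ∈ resonantSet ω₂ k₁ k₃ := by
  refine ⟨Generic.toIocMod_mem_cell k₂, ?_⟩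
  obtain ⟨n, hn⟩ := Generic.exists_toIocMod_eq_add (-π) k₂
  rw [hn, Generic.resonanceFn_snd_add_int_mul_two_pi, h]

/-- The exchange root `k₃ mod 2π` is resonant. [folklore] -/
theorem toIocMod_mem_resonantSet (ω₂ k₁ k₃ : ℝ) :
    toIocMod Real.two_pi_pos (-π) k₃ ∈ resonantSet ω₂ k₁ k₃ :=
  toIocMod_mem_resonantSet_of_zero (resonanceFn_self ω₂ k₁ k₃)

/-- On the diagonal the group velocities agree. [folklore] -/
theorem groupVelocity_eq_of_diag {k₁ k₃ : ℝ} (hd : ∃ n : ℤ, k₃ - k₁ = n * (2 * π)) :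
    groupVelocity ω₂ k₃ = groupVelocity ω₂ k₁ := by
  obtain ⟨n, hn⟩ := hd
  rw [show k₃ = k₁ + n * (2 * π) by linarith]
  exact (groupVelocity_periodic ω₂).int_mul n k₁

/-! ## Two non-trivial cell roots coincide -/

/-- **Uniqueness of the non-trivial cell root.** Off the diagonal two resonant `k₂`'s of the cell,
both different from the exchange root `k₃ mod 2π`, are equal. [folklore] -/
theorem eq_of_mem_resonantSet_of_ne (hω : 0 < ω₂) {k₁ k₃ a b : ℝ}
    (ht : ∀ n : ℤ, k₃ - k₁ ≠ n * (2 * π)) (ha : a ∈ resonantSet ω₂ k₁ k₃)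
    (hb : b ∈ resonantSet ω₂ k₁ k₃) (ha' : a ≠ toIocMod Real.two_pi_pos (-π) k₃)
    (hb' : b ≠ toIocMod Real.two_pi_pos (-π) k₃) : a = b := by
  have hm := toIocMod_mem_resonantSet ω₂ k₁ k₃
  rcases two_classes hω ht hm.2 ha.2 hb.2 with h | h | h
  · exact absurd (eq_of_mem_cell hm.1 ha.1 h) ha'
  · exact absurd (eq_of_mem_cell hm.1 hb.1 h) hb'
  · exact (eq_of_mem_cell ha.1 hb.1 h).symm

/-! ## Partner selectors -/

/-- **Partner selectors exist**: a resonant `h k₁ k₃` (H1), equal to `k₃ mod 2π` on the diagonal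
(H2), and off the diagonal equal to `k₃ mod 2π` only when nothing else is resonant (H3).
[folklore] -/
theorem exists_selector (ω₂ : ℝ) : ∃ h : ℝ → ℝ → ℝ,
    (∀ k₁ k₃, h k₁ k₃ ∈ resonantSet ω₂ k₁ k₃) ∧
    (∀ k₁ k₃, (∃ n : ℤ, k₃ - k₁ = n * (2 * π)) → h k₁ k₃ = toIocMod Real.two_pi_pos (-π) k₃) ∧
    (∀ k₁ k₃, (∀ n : ℤ, k₃ - k₁ ≠ n * (2 * π)) → h k₁ k₃ = toIocMod Real.two_pi_pos (-π) k₃ →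
      resonantSet ω₂ k₁ k₃ ⊆ {toIocMod Real.two_pi_pos (-π) k₃}) := by
  classical
  refine ⟨fun k₁ k₃ => if (∃ n : ℤ, k₃ - k₁ = n * (2 * π)) then toIocMod Real.two_pi_pos (-π) k₃
    else if H : (resonantSet ω₂ k₁ k₃ \ {toIocMod Real.two_pi_pos (-π) k₃}).Nonempty then H.some
    else toIocMod Real.two_pi_pos (-π) k₃, ?_, ?_, ?_⟩
  · intro k₁ k₃
    dsimp only
    split_ifs with h1 h2
    · exact toIocMod_mem_resonantSet ω₂ k₁ k₃
    · exact h2.some_mem.1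
    · exact toIocMod_mem_resonantSet ω₂ k₁ k₃
  · intro k₁ k₃ hd
    dsimp only
    rw [if_pos hd]
  · intro k₁ k₃ ht hh
    dsimp only at hh
    rw [if_neg (fun ⟨n, hn⟩ => ht n hn)] at hh
    split_ifs at hh with h2
    · exact absurd hh h2.some_mem.2
    · intro k₂ hk₂
      by_contra hne
      exact h2 ⟨k₂, hk₂, hne⟩

/-- **Off the diagonal the resonant set is `{k₃ mod 2π, h k₁ k₃}`** for any selector (H1, H3).
[folklore] -/
theorem resonantSet_eq_pair (hω : 0 < ω₂) {h : ℝ → ℝ → ℝ}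
    (H1 : ∀ k₁ k₃, h k₁ k₃ ∈ resonantSet ω₂ k₁ k₃)
    (H3 : ∀ k₁ k₃, (∀ n : ℤ, k₃ - k₁ ≠ n * (2 * π)) → h k₁ k₃ = toIocMod Real.two_pi_pos (-π) k₃ →
      resonantSet ω₂ k₁ k₃ ⊆ {toIocMod Real.two_pi_pos (-π) k₃})
    {k₁ k₃ : ℝ} (ht : ∀ n : ℤ, k₃ - k₁ ≠ n * (2 * π)) :
    resonantSet ω₂ k₁ k₃ = {toIocMod Real.two_pi_pos (-π) k₃, h k₁ k₃} := by
  apply Subset.antisymm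
  · intro k₂ hk₂
    by_cases hm : k₂ = toIocMod Real.two_pi_pos (-π) k₃
    · exact Or.inl hm
    by_cases hh : h k₁ k₃ = toIocMod Real.two_pi_pos (-π) k₃
    · exact absurd (H3 k₁ k₃ ht hh hk₂) hm
    exact Or.inr (eq_of_mem_resonantSet_of_ne hω ht hk₂ (H1 k₁ k₃) hm hh)
  · rintro k₂ (rfl | rfl)
    · exact toIocMod_mem_resonantSet ω₂ k₁ k₃
    · exact H1 k₁ k₃

/-- Selector values depend only on the resonance data: equal resonant sets, equal `k₃ mod 2π` and
the same diagonal status give equal values. [folklore] -/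
theorem selector_congr (hω : 0 < ω₂) {h : ℝ → ℝ → ℝ}
    (H1 : ∀ k₁ k₃, h k₁ k₃ ∈ resonantSet ω₂ k₁ k₃)
    (H2 : ∀ k₁ k₃, (∃ n : ℤ, k₃ - k₁ = n * (2 * π)) → h k₁ k₃ = toIocMod Real.two_pi_pos (-π) k₃)
    (H3 : ∀ k₁ k₃, (∀ n : ℤ, k₃ - k₁ ≠ n * (2 * π)) → h k₁ k₃ = toIocMod Real.two_pi_pos (-π) k₃ →
      resonantSet ω₂ k₁ k₃ ⊆ {toIocMod Real.two_pi_pos (-π) k₃})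
    {k₁ k₃ k₁' k₃' : ℝ} (hS : resonantSet ω₂ k₁' k₃' = resonantSet ω₂ k₁ k₃)
    (hm : toIocMod Real.two_pi_pos (-π) k₃' = toIocMod Real.two_pi_pos (-π) k₃)
    (hdiag : (∃ n : ℤ, k₃' - k₁' = n * (2 * π)) ↔ (∃ n : ℤ, k₃ - k₁ = n * (2 * π))) :
    h k₁' k₃' = h k₁ k₃ := by
  by_cases hd : ∃ n : ℤ, k₃ - k₁ = n * (2 * π)
  · rw [H2 k₁ k₃ hd, H2 k₁' k₃' (hdiag.2 hd), hm]
  have ht : ∀ n : ℤ, k₃ - k₁ ≠ n * (2 * π) := fun n hn => hd ⟨n, hn⟩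
  have ht' : ∀ n : ℤ, k₃' - k₁' ≠ n * (2 * π) := fun n hn => hd (hdiag.1 ⟨n, hn⟩)
  have ha : h k₁' k₃' ∈ resonantSet ω₂ k₁ k₃ := hS ▸ H1 k₁' k₃'
  have hb : h k₁ k₃ ∈ resonantSet ω₂ k₁ k₃ := H1 k₁ k₃
  by_cases ha' : h k₁' k₃' = toIocMod Real.two_pi_pos (-π) k₃'
  · have hsub := H3 k₁' k₃' ht' ha'
    rw [hS, hm] at hsub
    rw [ha', hm, show h k₁ k₃ = toIocMod Real.two_pi_pos (-π) k₃ from hsub hb]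
  by_cases hb' : h k₁ k₃ = toIocMod Real.two_pi_pos (-π) k₃
  · have hsub := H3 k₁ k₃ ht hb'
    exact absurd ((hsub ha).trans hm.symm) ha'
  rw [hm] at ha'
  exact eq_of_mem_resonantSet_of_ne hω ht ha hb ha' hb'

/-- **Selectors are doubly `2π`-periodic.** [folklore] -/
theorem selector_periodic (hω : 0 < ω₂) {h : ℝ → ℝ → ℝ}
    (H1 : ∀ k₁ k₃, h k₁ k₃ ∈ resonantSet ω₂ k₁ k₃)
    (H2 : ∀ k₁ k₃, (∃ n : ℤ, k₃ - k₁ = n * (2 * π)) → h k₁ k₃ = toIocMod Real.two_pi_pos (-π) k₃)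
    (H3 : ∀ k₁ k₃, (∀ n : ℤ, k₃ - k₁ ≠ n * (2 * π)) → h k₁ k₃ = toIocMod Real.two_pi_pos (-π) k₃ →
      resonantSet ω₂ k₁ k₃ ⊆ {toIocMod Real.two_pi_pos (-π) k₃}) (k₁ k₃ : ℝ) :
    h (k₁ + 2 * π) k₃ = h k₁ k₃ ∧ h k₁ (k₃ + 2 * π) = h k₁ k₃ := by
  constructor
  · refine selector_congr hω H1 H2 H3 (resonantSet_add_two_pi ω₂ k₁ k₃) rfl ⟨?_, ?_⟩
    · rintro ⟨n, hn⟩; exact ⟨n + 1, by push_cast; linarith⟩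
    · rintro ⟨n, hn⟩; exact ⟨n - 1, by push_cast; linarith⟩
  · refine selector_congr hω H1 H2 H3 (resonantSet_add_two_pi₃ ω₂ k₁ k₃)
      (toIocMod_add_two_pi_eq k₃) ⟨?_, ?_⟩
    · rintro ⟨n, hn⟩; exact ⟨n - 1, by push_cast; linarith⟩
    · rintro ⟨n, hn⟩; exact ⟨n + 1, by push_cast; linarith⟩

/-- On the diagonal of the cell a selector is the identity: `h k k = k`. [folklore] -/
theorem selector_diag {h : ℝ → ℝ → ℝ}
    (H2 : ∀ k₁ k₃, (∃ n : ℤ, k₃ - k₁ = n * (2 * π)) → h k₁ k₃ = toIocMod Real.two_pi_pos (-π) k₃)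
    {k : ℝ} (hk : k ∈ Ioc (-π) π) : h k k = k := by
  rw [H2 k k ⟨0, by simp⟩, toIocMod_eq_self_of_mem hk]

/-- **The branch is trivial exactly on the equal-velocity curve**: off the diagonal,
`h k₁ k₃ = k₃ mod 2π ↔ v(k₃) = v(k₁)`. [folklore] -/
theorem selector_trivial_iff (hω : 0 < ω₂) {h : ℝ → ℝ → ℝ}
    (H1 : ∀ k₁ k₃, h k₁ k₃ ∈ resonantSet ω₂ k₁ k₃)
    (H3 : ∀ k₁ k₃, (∀ n : ℤ, k₃ - k₁ ≠ n * (2 * π)) → h k₁ k₃ = toIocMod Real.two_pi_pos (-π) k₃ →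
      resonantSet ω₂ k₁ k₃ ⊆ {toIocMod Real.two_pi_pos (-π) k₃})
    {k₁ k₃ : ℝ} (ht : ∀ n : ℤ, k₃ - k₁ ≠ n * (2 * π)) :
    h k₁ k₃ = toIocMod Real.two_pi_pos (-π) k₃ ↔ groupVelocity ω₂ k₃ = groupVelocity ω₂ k₁ := by
  constructor
  · intro hh
    have hsub := H3 k₁ k₃ ht hh
    by_contra hv
    have hv' : groupVelocity ω₂ k₃ ≠ groupVelocity ω₂ (k₁ + k₃ - k₃) := by
      rwa [show k₁ + k₃ - k₃ = k₁ by ring]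
    obtain ⟨b, hb, hbn⟩ := exists_other_zero hω (resonanceFn_self ω₂ k₁ k₃) hv'
    have hbm : toIocMod Real.two_pi_pos (-π) b = toIocMod Real.two_pi_pos (-π) k₃ :=
      hsub (toIocMod_mem_resonantSet_of_zero hb)
    obtain ⟨n, hn⟩ := modEq_of_toIocMod_eq hbm.symm
    exact hbn (-n) (by push_cast; linarith)
  · intro hv
    have hv' : groupVelocity ω₂ k₃ = groupVelocity ω₂ (k₁ + k₃ - k₃) := by
      rwa [show k₁ + k₃ - k₃ = k₁ by ring]
    have hmod := modEq_of_velocity_eq hω ht (resonanceFn_self ω₂ k₁ k₃) (H1 k₁ k₃).2 hv'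
    have hm : ∃ n : ℤ, h k₁ k₃ - toIocMod Real.two_pi_pos (-π) k₃ = n * (2 * π) := by
      obtain ⟨n, hn⟩ := hmod
      obtain ⟨a, ha⟩ := toIocMod_sub_eq_int k₃
      exact ⟨n - a, by push_cast; linarith⟩
    exact eq_of_mem_cell (Generic.toIocMod_mem_cell k₃) (H1 k₁ k₃).1 hm

/-- **Off the equal-velocity curve the resolved energy delta at the branch is non-degenerate**:
`v(h) ≠ v(k₁ + h - k₃)`. [folklore] -/
theorem selector_velocity_ne (hω : 0 < ω₂) {h : ℝ → ℝ → ℝ}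
    (H1 : ∀ k₁ k₃, h k₁ k₃ ∈ resonantSet ω₂ k₁ k₃)
    (H3 : ∀ k₁ k₃, (∀ n : ℤ, k₃ - k₁ ≠ n * (2 * π)) → h k₁ k₃ = toIocMod Real.two_pi_pos (-π) k₃ →
      resonantSet ω₂ k₁ k₃ ⊆ {toIocMod Real.two_pi_pos (-π) k₃})
    {k₁ k₃ : ℝ} (hv : groupVelocity ω₂ k₃ ≠ groupVelocity ω₂ k₁) :
    groupVelocity ω₂ (h k₁ k₃) ≠ groupVelocity ω₂ (k₁ + h k₁ k₃ - k₃) := by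
  have ht := Generic.sub_ne_of_groupVelocity_ne hv
  have hne : h k₁ k₃ ≠ toIocMod Real.two_pi_pos (-π) k₃ := fun hh =>
    hv ((selector_trivial_iff hω H1 H3 ht).1 hh)
  intro hveq
  have hmod := modEq_of_velocity_eq hω ht (H1 k₁ k₃).2 (resonanceFn_self ω₂ k₁ k₃) hveq
  have hm : ∃ n : ℤ, h k₁ k₃ - toIocMod Real.two_pi_pos (-π) k₃ = n * (2 * π) := by
    obtain ⟨n, hn⟩ := hmod
    obtain ⟨a, ha⟩ := toIocMod_sub_eq_int k₃
    exact ⟨-n - a, by push_cast; linarith⟩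
  exact hne (eq_of_mem_cell (Generic.toIocMod_mem_cell k₃) (H1 k₁ k₃).1 hm)

end Branch

open Branch in
/-- **GA, part B (the partner map, elementary clauses).** For `ω₂ > 0` there is a cell-valued,
resonant, doubly `2π`-periodic partner map `h` with `h k k = k` on the cell, such that off the
diagonal the resonant set is `{k₃ mod 2π, h k₁ k₃}`, the branch is trivial iff `v(k₃) = v(k₁)`,
and off that curve `v(h) ≠ v(k₁ + h - k₃)`. [folklore] -/
theorem stub_branchStructure_partB :
    ∀ ω₂ : ℝ, 0 < ω₂ → ∃ h : ℝ → ℝ → ℝ, ((∀ k₁ k₃ : ℝ, h k₁ k₃ ∈ Set.Ioc (-π) π) ∧ (∀ k₁ k₃ : ℝ, resonanceFn ω₂ k₁ (h k₁ k₃) k₃ = 0) ∧ (∀ k₁ k₃ : ℝ, h (k₁ + 2 * π) k₃ = h k₁ k₃ ∧ h k₁ (k₃ + 2 * π) = h k₁ k₃) ∧ (∀ k : ℝ, k ∈ Set.Ioc (-π) π → h k k = k) ∧ (∀ k₁ k₃ : ℝ, (∀ n : ℤ, k₃ - k₁ ≠ n * (2 * π)) → resonantSet ω₂ k₁ k₃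 = {toIocMod Real.two_pi_pos (-π) k₃, h k₁ k₃}) ∧ (∀ k₁ k₃ : ℝ, (∀ n : ℤ, k₃ - k₁ ≠ n * (2 * π)) → (h k₁ k₃ = toIocMod Real.two_pi_pos (-π) k₃ ↔ groupVelocity ω₂ k₃ = groupVelocity ω₂ k₁)) ∧ (∀ k₁ k₃ : ℝ, groupVelocity ω₂ k₃ ≠ groupVelocity ω₂ k₁ → groupVelocity ω₂ (h k₁ k₃) ≠ groupVelocity ω₂ (k₁ + h k₁ k₃ - k₃))) := by
  intro ω₂ hω
  obtain ⟨h, H1, H2, H3⟩ := exists_selector ω₂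
  exact ⟨h, fun k₁ k₃ => (H1 k₁ k₃).1, fun k₁ k₃ => (H1 k₁ k₃).2, selector_periodic hω H1 H2 H3,
    fun k hk => selector_diag H2 hk, fun k₁ k₃ ht => resonantSet_eq_pair hω H1 H3 ht,
    fun k₁ k₃ ht => selector_trivial_iff hω H1 H3 ht,
    fun k₁ k₃ hv => selector_velocity_ne hω H1 H3 hv⟩

end Summit.AtomisticToContinuum.FouriersLaw.Theorems.FGRGap.FoldJetRigidity

end
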